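import Summits.SmoothPoincare4.SmoothPoincare4.Theses.WeakReductionDescent
import Literature.Topology.FourManifolds.WeaklyReducibleTrisections
import Literature.Topology.FourManifolds.CircleSurgery
import Literature.Barriers.SmoothPoincare4.WeaklyReducibleGenusThreeStandard

/-!
# Crux `WeakReductionReduces` (stmt-SmoothPoincare4-17908), line `loop_dichotomy`, stub D₅
# (`stub_loopDichotomyFromFive`) — the stub is cut to its IRREDUCIBLE FIXED-LABEL CORE (proved glue)

Stub D₅ of skeleton v3 (lead seat c1, `Cruxes/WeakReductionReduces/Lines/loop_dichotomy.lean`, sha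
66732100…): for a smooth homotopy 4-sphere `M` (bare binders + `e : M ≃ₕ S⁴`) and a weakly reducible
`(g; k)`-GK-trisection `T` with `g ≥ 5`, `k₀ + k₁ + k₂ = g`, all `kᵢ + 2 ≤ g` (the types left by
`χ(M) = 2` outside the Meier–Schirmer–Zupan range): `T` is reducible, OR `M` has a GK-trisection of
genus `< g`, OR `M` is a surgery on a smoothly embedded loop in a smooth `X` carrying a GK-trisection
of genus `< g` — Aranda–Zupan's Theorem 1.3 (arXiv:2503.04607; genus THREE) one genus (and more) up,
which is NOT in print (worker log `work/stubs/stub_loopDichotomyFromFive.log.md`: of the printed proof,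
§5 — five-chain surgery, Lemma 5.4 and Prop. 5.5 — is general-genus and feeds the third exit, while
Prop. 3.9 (tri-primitivity, via the genus-two Lemmas 3.4–3.8) and the genus-two Heegaard-triple
rigidity of §4 (Prop. 4.3, Thm. 4.8, on [MZ17b] and the wave theorem) have no analogue for surfaces
of genus `≥ 3`).

This file does for D₅ what the barrier catalogue does for the genus-three fact
(`Literature.Barriers.SmoothPoincare4.az2025_weaklyReducible_genusThree_homotopySphere_gk_of_zero`,
`…ProofsOfLoopSurgery.az2025_irreducibleCore_zero_of_loopSurgery_of_fiveChainSurgery`): it PROVES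
that D₅ follows from its **irreducible fixed-label core** — the same statement for trisections that
are NOT reducible and whose weak reduction has the labels fixed, `c` compressing in
`H₀ = T 1 ∩ T 2` and `c′` in `H₁ = T 0 ∩ T 2` and `H₂ = T 0 ∩ T 1` (so that `c′` is a non-separating
reducing curve of the genus-`g` Heegaard splitting `H₁ ∪_F H₂ = ∂(T 0) ≅ #^{k₀}(S¹ × S²)`), with
the conclusion "smaller trisection of `M` ∨ loop surgery on a smaller-genus trisected `X`".  The
reduction is Aranda–Zupan's opening move (§2 p. 6: the labels `α`, `β = γ` are fixed by a symmetry
of the three sectors; §6 p. 20: "either `T` is reducible, completing the proof, or …"): relabel the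
sectors by the transposition `(0 p)` (`IsGKTrisection.comp_perm`, PROVED), under which the type
hypotheses `Σ kᵢ = g`, `kᵢ + 2 ≤ g` are invariant, the central surface and the SET of handlebodies of
the spine are unchanged (so curves, discs, non-separation, (weak) reducibility are invariant:
`Literature.Barriers.SmoothPoincare4.Trisection.*_comp_perm`, PROVED, and `isReducible_comp_perm`
below), and the two remaining exits do not mention `T`.

Registered helper `helper_loopDichotomyFromFive_of_irreducibleCore : CORE₅ → D₅` (stub-add on the
crux; lands `--supports stmt-SmoothPoincare4-17908`).  Pure logic over PROVED tree theorems; no named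
fact is used, none is introduced.  What remains of D₅ after this file is exactly CORE₅ = "Aranda–Zupan
Thm. 1.3, first sentence, one genus up, for homotopy 4-spheres: an irreducible weakly reducible
`(g; k)`-trisection (`g ≥ 5`, non-MSZ type) of a homotopy 4-sphere contains a five-chain" followed by
the general-genus §5 (five-chain surgery ⇒ loop surgery on a `(g − 1; k₀′, k₁′, k₂′)`-trisected `X′`).

## References

* R. Aranda, A. Zupan, *Manifolds with weakly reducible genus-three trisections are standard*,
  arXiv:2503.04607 (2025): Thm. 1.3 (p. 2), §2 (p. 6), Prop. 3.9 (p. 10), §4 (pp. 11–16), Thm. 5.1,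
  Lemma 5.4, Prop. 5.5 (pp. 17–20), §6 (pp. 20–24). [ArandaZupan2025]
* D. Gay, R. Kirby, *Trisecting 4-manifolds*, Geom. Topol. 20 (2016), Def. 1. [GayKirby2016]
-/

-- the registered namespace `Summit.SmoothPoincare4.SmoothPoincare4.Theorems…` repeats a component
set_option linter.dupNamespace false

noncomputable section

open scoped Manifold ContDiff Topology ContinuousMap
open Set
open Literature.Topology.FourManifolds Literature.Topology.FourManifolds.Trisection

namespace Summit.SmoothPoincare4.SmoothPoincare4.Theorems.WeakReductionReduces.LoopDichotomy

/-- **Reducibility is invariant under relabelling the sectors**: a permutation `σ` of the labels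
fixes the central surface (`Trisection.centralSurfaceSet_comp_perm`) and permutes the handlebodies
of the spine (`spineHandlebody (S ∘ σ) q = spineHandlebody S (σ q)`), so an essential curve bounding
compressing discs in all three handlebodies of `S ∘ σ` is one for `S` and conversely (companion of
`Literature.Barriers.SmoothPoincare4.Trisection.isWeaklyReducible_comp_perm`).
[cite: ArandaZupan2025, §2 (p. 6)] -/
theorem isReducible_comp_perm {X : Type} [TopologicalSpace X]
    [ChartedSpace (EuclideanSpace ℝ (Fin 4)) X] (S : Fin 3 → Set X) (σ : Equiv.Perm (Fin 3)) :
    IsReducible (S ∘ σ) ↔ IsReducible S := by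
  unfold IsReducible
  rw [Literature.Barriers.SmoothPoincare4.Trisection.centralSurfaceSet_comp_perm]
  constructor
  · rintro ⟨δ, hc, hess, hb⟩
    refine ⟨δ, (Literature.Barriers.SmoothPoincare4.Trisection.isCurve_comp_perm S σ δ).1 hc, hess,
      fun q => ?_⟩
    have h := hb (σ.symm q)
    rwa [Literature.Barriers.SmoothPoincare4.Trisection.spineHandlebody_comp_perm,
      Literature.Barriers.SmoothPoincare4.Trisection.boundsDisc_comp_perm, Equiv.apply_symm_apply] at h
  · rintro ⟨δ, hc, hess, hb⟩
    refine ⟨δ, (Literature.Barriers.SmoothPoincare4.Trisection.isCurve_comp_perm S σ δ).2 hc, hess,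
      fun q => ?_⟩
    rw [Literature.Barriers.SmoothPoincare4.Trisection.spineHandlebody_comp_perm,
      Literature.Barriers.SmoothPoincare4.Trisection.boundsDisc_comp_perm]
    exact hb (σ q)

/-- **`helper_loopDichotomyFromFive_of_irreducibleCore` : CORE₅ → D₅** (registered helper of crux
stmt-SmoothPoincare4-17908, line `loop_dichotomy`, stub `stub_loopDichotomyFromFive`).  D₅ — a weakly
reducible `(g; k)`-GK-trisection `T` of a smooth homotopy 4-sphere, `g ≥ 5`, `Σ kᵢ = g`, all
`kᵢ + 2 ≤ g`, is reducible or `M` has a smaller-genus GK-trisection or `M` is a loop surgery on a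
smaller-genus trisected `X` — follows from the same statement for trisections that are NOT reducible
and carry a weak reduction WITH FIXED LABELS (`c` compressing in `H₀`, `c′` in `H₁` and `H₂`):
if `T` is reducible the first exit holds; otherwise take the weak reduction at label `p` and relabel
the sectors by the transposition `(0 p)` (`IsGKTrisection.comp_perm`), which carries `H_p` to the
`H₀` of `T ∘ (0 p)`, keeps `Σ kᵢ = g` (`Equiv.sum_comp`) and `kᵢ + 2 ≤ g`, keeps curves, discs and
non-separation (`Trisection.*_comp_perm`) and irreducibility (`isReducible_comp_perm`); the core's two
exits speak of `M` only.  (Aranda–Zupan fix the labels the same way, §2 p. 6, and open the proof of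
Thm. 1.3 with "either `T` is reducible, completing the proof, or …", §6 p. 20.)
[cite: ArandaZupan2025, §2 (p. 6), §6 (p. 20), Thm. 1.3 (p. 2)] [cite: GayKirby2016, Def. 1] -/
theorem helper_loopDichotomyFromFive_of_irreducibleCore :
    (∀ (M : Type) [TopologicalSpace M] [T2Space M] [SecondCountableTopology M] [ChartedSpace (EuclideanSpace ℝ (Fin 4)) M] [IsManifold (𝓡 4) ((⊤ : ℕ∞) : WithTop ℕ∞) M], (M ≃ₕ (Metric.sphere (0 : EuclideanSpace ℝ (Fin 5)) 1)) → ∀ (g : ℕ) (k : Fin 3 → ℕ) (T : Fin 3 → Set M), Literature.Topology.FourManifolds.IsGKTrisection M g k T → 5 ≤ g → k 0 + k 1 + k 2 = g → (∀ i, k i + 2 ≤ g) → (∃ c c' : Set M, Literature.Topology.FourManifolds.Trisection.IsCurve T c ∧ Literature.Topology.FourManifolds.Trisection.IsCurve T c' ∧ Disjoint c c' ∧ Literature.Topology.FourManifolds.Trisection.IsNonSeparating T c ∧ Literature.Topology.FourManifolds.Trisection.IsNonSeparating T c' ∧ Literature.Topology.FourManifolds.Trisection.BoundsDisc T (Literature.Topology.FourManifolds.Trisection.spineHandlebody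 T 0) c ∧ Literature.Topology.FourManifolds.Trisection.BoundsDisc T (Literature.Topology.FourManifolds.Trisection.spineHandlebody T 1) c' ∧ Literature.Topology.FourManifolds.Trisection.BoundsDisc T (Literature.Topology.FourManifolds.Trisection.spineHandlebody T 2) c') → ¬ Literature.Topology.FourManifolds.Trisection.IsReducible T → (∃ (g₁ : ℕ) (k₁ : Fin 3 → ℕ) (T₁ : Fin 3 → Set M), g₁ < g ∧ Literature.Topology.FourManifolds.IsGKTrisection M g₁ k₁ T₁) ∨ (∃ (X : Type) (_ : TopologicalSpace X) (_ : T2Space X) (_ : SecondCountableTopology X) (_ : ChartedSpace (EuclideanSpace ℝ (Fin 4)) X) (_ : IsManifold (𝓡 4) ((⊤ : ℕ∞) : WithTop ℕ∞) X) (g' : ℕ) (k' : Fin 3 → ℕ) (T' : Fin 3 → Set X) (ℓ : (Metric.sphere (0 : EuclideanSpace ℝ (Fin 2)) 1) → X), g' < g ∧ Literature.Topology.FourManifolds.IsGKTrisection X g' k' T' ∧ Manifold.IsSmoothEmbedding (𝓡 1) (𝓡 4) ((⊤ : ℕ∞) : WithTop ℕ∞) ℓ ∧ Literature.Topology.FourManifolds.IsCircleSurgery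 (𝓡 4) (𝓡 4) X M ℓ)) → ∀ (M : Type) [TopologicalSpace M] [T2Space M] [SecondCountableTopology M] [ChartedSpace (EuclideanSpace ℝ (Fin 4)) M] [IsManifold (𝓡 4) ((⊤ : ℕ∞) : WithTop ℕ∞) M], (M ≃ₕ (Metric.sphere (0 : EuclideanSpace ℝ (Fin 5)) 1)) → ∀ (g : ℕ) (k : Fin 3 → ℕ) (T : Fin 3 → Set M), Literature.Topology.FourManifolds.IsGKTrisection M g k T → 5 ≤ g → k 0 + k 1 + k 2 = g → (∀ i, k i + 2 ≤ g) → Literature.Topology.FourManifolds.Trisection.IsWeaklyReducible T → Literature.Topology.FourManifolds.Trisection.IsReducible T ∨ (∃ (g₁ : ℕ) (k₁ : Fin 3 → ℕ) (T₁ : Fin 3 → Set M), g₁ < g ∧ Literature.Topology.FourManifolds.IsGKTrisection M g₁ k₁ T₁) ∨ (∃ (X : Type) (_ : TopologicalSpace X) (_ : T2Space X) (_ : SecondCountableTopology X) (_ : ChartedSpace (EuclideanSpace ℝ (Fin 4)) X) (_ : IsManifold (𝓡 4) ((⊤ : ℕ∞) : WithTop ℕ∞) X) (g' : ℕ) (k'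 : Fin 3 → ℕ) (T' : Fin 3 → Set X) (ℓ : (Metric.sphere (0 : EuclideanSpace ℝ (Fin 2)) 1) → X), g' < g ∧ Literature.Topology.FourManifolds.IsGKTrisection X g' k' T' ∧ Manifold.IsSmoothEmbedding (𝓡 1) (𝓡 4) ((⊤ : ℕ∞) : WithTop ℕ∞) ℓ ∧ Literature.Topology.FourManifolds.IsCircleSurgery (𝓡 4) (𝓡 4) X M ℓ) := by
  intro hcore M _ _ _ _ _ e g k T hT hg hsum hk hwr
  by_cases hred : IsReducible T
  · exact Or.inl hred
  · obtain ⟨p, c, c', hc, hc', hd, hn, hn', hb, hb'⟩ := hwr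
    have hσ0 : Equiv.swap (0 : Fin 3) p 0 = p := Equiv.swap_apply_left 0 p
    have hne : ∀ q : Fin 3, q ≠ 0 → Equiv.swap (0 : Fin 3) p q ≠ p := fun q hq heq =>
      hq ((Equiv.swap (0 : Fin 3) p).injective (heq.trans hσ0.symm))
    have hT' : IsGKTrisection M g (k ∘ Equiv.swap (0 : Fin 3) p) (T ∘ Equiv.swap (0 : Fin 3) p) :=
      hT.comp_perm _
    have hsum' : (k ∘ Equiv.swap (0 : Fin 3) p) 0 + (k ∘ Equiv.swap (0 : Fin 3) p) 1 +
        (k ∘ Equiv.swap (0 : Fin 3) p) 2 = g := by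
      have h := Equiv.sum_comp (Equiv.swap (0 : Fin 3) p) k
      simp only [Fin.sum_univ_three] at h
      simp only [Function.comp_apply]
      omega
    have hk' : ∀ i, (k ∘ Equiv.swap (0 : Fin 3) p) i + 2 ≤ g := fun i => hk _
    have hred' : ¬ IsReducible (T ∘ Equiv.swap (0 : Fin 3) p) := fun h =>
      hred ((isReducible_comp_perm T _).1 h)
    have hwr' : ∃ c c' : Set M, IsCurve (T ∘ Equiv.swap (0 : Fin 3) p) c ∧
        IsCurve (T ∘ Equiv.swap (0 : Fin 3) p) c' ∧ Disjoint c c' ∧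
        IsNonSeparating (T ∘ Equiv.swap (0 : Fin 3) p) c ∧
        IsNonSeparating (T ∘ Equiv.swap (0 : Fin 3) p) c' ∧
        BoundsDisc (T ∘ Equiv.swap (0 : Fin 3) p)
          (spineHandlebody (T ∘ Equiv.swap (0 : Fin 3) p) 0) c ∧
        BoundsDisc (T ∘ Equiv.swap (0 : Fin 3) p)
          (spineHandlebody (T ∘ Equiv.swap (0 : Fin 3) p) 1) c' ∧
        BoundsDisc (T ∘ Equiv.swap (0 : Fin 3) p)
          (spineHandlebody (T ∘ Equiv.swap (0 : Fin 3) p) 2) c' := by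
      refine ⟨c, c', (Literature.Barriers.SmoothPoincare4.Trisection.isCurve_comp_perm T _ c).2 hc,
        (Literature.Barriers.SmoothPoincare4.Trisection.isCurve_comp_perm T _ c').2 hc', hd,
        (Literature.Barriers.SmoothPoincare4.Trisection.isNonSeparating_comp_perm T _ c).2 hn,
        (Literature.Barriers.SmoothPoincare4.Trisection.isNonSeparating_comp_perm T _ c').2 hn',
        ?_, ?_, ?_⟩
      · rw [Literature.Barriers.SmoothPoincare4.Trisection.spineHandlebody_comp_perm,
          Literature.Barriers.SmoothPoincare4.Trisection.boundsDisc_comp_perm, hσ0]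
        exact hb
      · rw [Literature.Barriers.SmoothPoincare4.Trisection.spineHandlebody_comp_perm,
          Literature.Barriers.SmoothPoincare4.Trisection.boundsDisc_comp_perm]
        exact hb' _ (hne 1 (by decide))
      · rw [Literature.Barriers.SmoothPoincare4.Trisection.spineHandlebody_comp_perm,
          Literature.Barriers.SmoothPoincare4.Trisection.boundsDisc_comp_perm]
        exact hb' _ (hne 2 (by decide))
    rcases hcore M e g _ _ hT' hg hsum' hk' hwr' hred' with h2 | h3
    · exact Or.inr (Or.inl h2)
    · exact Or.inr (Or.inr h3)

end Summit.SmoothPoincare4.SmoothPoincare4.Theorems.WeakReductionReduces.LoopDichotomy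

end
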